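import Literature.Geometry.GeometricMeasureTheory.SphericalMeasureImage
import Literature.Geometry.GeometricMeasureTheory.RectifiablePieces
import Literature.Analysis.Calculus.ApproximatesLinearHausdorff
import HarnessLib

/-!
# Upper density at most one on countably rectifiable sets

Support file for the proof of the named fact
`Literature.Geometry.GeometricMeasureTheory.Federer1969_compactness_integralCurrents` along
B. White's structure-theorem-free proof of the closure theorem [White1989]: the blow-up argument
(`BlowUpCycle`, `BlowUpTangentPlane`) is run a second time with `σ = 𝓗^{k+1} ⌞ M₁` on the
countably rectifiable carrier `M₁` produced by `RectifiabilityCriterion`, and needs the sharp bound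
`Θ^{*(k+1)}(𝓗^{k+1} ⌞ M₁, a) ≤ 1` at almost every point (hypothesis `hup` of
`vagueTendsto_blowUp_of_good`). This is the upper half of the density theorem for rectifiable
sets [Federer1969, 3.2.19; Mattila1995, 16.2; Maggi2012, (10.7)], proved here WITHOUT the
isodiametric inequality, for Mathlib's normalised Hausdorff measure `μHE[k+1]` (which agrees with
Lebesgue measure on `(k+1)`-planes):

* `norm_sub_le_of_approximatesLinearOn`, `injOn_of_approximatesLinearOn` — on a piece `s` where
  `f` is `δ`-approximately a `K`-antilipschitz linear map `A` with `Kδ < 1`,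
  `(1 − Kδ)‖A x − A y‖ ≤ ‖f x − f y‖`;
* `euclideanHausdorffMeasure_image_inter_closedBall_le` — hence
  `𝓗^{k+1}(f(s) ∩ 𝐁(f x₀, r)) ≤ ((1+Kδ)/(1−Kδ))^{k+1} α(k+1) r^{k+1}` (`f(s)` is a
  `(1+Kδ)`-Lipschitz image of a subset of the plane `A(P)` contained in a ball of radius
  `r/(1−Kδ)`; [Federer1969, 3.2.3 (proof), 2.10.35]), and `upperDensity_restrict_image_le`:
  `Θ^{*(k+1)}(𝓗^{k+1} ⌞ f(s), y) ≤ ((1+Kδ)/(1−Kδ))^{k+1}` at EVERY `y ∈ f(s)`;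
* **`ae_upperDensity_restrict_le_one_of_isCountablyRectifiable`** — for a Borel countably
  `(k+1)`-rectifiable `M` with `𝓗^{k+1}(M) < ∞`: `Θ^{*(k+1)}(𝓗^{k+1} ⌞ M, a) ≤ 1` for
  `𝓗^{k+1}`-a.e. `a ∈ M` (cover `M`, up to a null set, by pieces as above with `Kδ = δ₀`
  arbitrarily small — Rademacher, Sard's lemma for Lipschitz maps
  (`hausdorffMeasure_image_compl_good_eq_zero`) and Mathlib's
  `exists_partition_approximatesLinearOn_of_hasFDerivWithinAt` — and discard the other pieces by
  `Θ^{*}(𝓗^{k+1} ⌞ (M ∖ G), ·) = 0` a.e. on `G` [Federer1969, 2.10.19 (4)]);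
* `ae_eventually_closedBall_le_of_isCountablyRectifiable` — the same in the `hup` form
  `∀ t > 1, ∀ᶠ r → 0+, (𝓗^{k+1} ⌞ M)(𝐁(a, r)) ≤ t α(k+1) r^{k+1}`.

## References

* H. Federer, *Geometric Measure Theory*, Springer 1969, 2.10.19 (4), 3.2.3, 3.2.19
  [Federer1969].
* P. Mattila, *Geometry of Sets and Measures in Euclidean Spaces*, CUP 1995, 16.2 [Mattila1995].
* F. Maggi, *Sets of Finite Perimeter and Geometric Variational Problems*, CUP 2012, Thm. 10.2,
  (10.7) [Maggi2012].
* B. White, *A new proof of the compactness theorem for integral currents*, Comment. Math. Helv.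
  64 (1989) 207–220 [White1989].
-/

noncomputable section

open scoped ENNReal NNReal Topology
open MeasureTheory TopologicalSpace Set Filter Metric Function

namespace Literature.Geometry.GeometricMeasureTheory

open Literature.Analysis.Calculus

variable {V : Type*} [NormedAddCommGroup V] [InnerProductSpace ℝ V] [FiniteDimensional ℝ V]
  [MeasurableSpace V] [BorelSpace V] {k : ℕ}

/-! ### One almost-linear piece -/

section Piece

variable {P : Type*} [NormedAddCommGroup P] [InnerProductSpace ℝ P] [FiniteDimensional ℝ P]
  [MeasurableSpace P] [BorelSpace P]
  {f : P → V} {A : P →L[ℝ] V} {s : Set P} {K δ : ℝ≥0}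

omit [FiniteDimensional ℝ V] [MeasurableSpace V] [BorelSpace V] [FiniteDimensional ℝ P]
  [MeasurableSpace P] [BorelSpace P] in
/-- **Lower estimate on an almost-linear piece**: if `f` is `δ`-approximately the
`K`-antilipschitz linear map `A` on `s`, then `(1 − Kδ)‖A x − A y‖ ≤ ‖f x − f y‖` on `s`.
[cite: Federer1969, 3.2.3 (proof)] -/
theorem norm_sub_le_of_approximatesLinearOn (hA : AntilipschitzWith K A)
    (happ : ApproximatesLinearOn f A s δ) {x y : P} (hx : x ∈ s) (hy : y ∈ s) :
    (1 - K * δ) * ‖A x - A y‖ ≤ ‖f x - f y‖ := by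
  have h1 : ‖f x - f y - A (x - y)‖ ≤ δ * ‖x - y‖ := happ x hx y hy
  have h2 : ‖x - y‖ ≤ K * ‖A x - A y‖ := by
    rw [← dist_eq_norm, ← dist_eq_norm]; exact hA.le_mul_dist x y
  have h3 : ‖A (x - y)‖ ≤ ‖f x - f y‖ + ‖f x - f y - A (x - y)‖ := by
    have := norm_le_norm_add_norm_sub' (A (x - y)) (f x - f y)
    rwa [norm_sub_rev (A (x - y))] at this
  have h4 : (δ : ℝ) * ‖x - y‖ ≤ δ * (K * ‖A x - A y‖) := mul_le_mul_of_nonneg_left h2 δ.coe_nonneg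
  have hAsub : ‖A (x - y)‖ = ‖A x - A y‖ := by rw [map_sub]
  nlinarith [h1, h3, h4, hAsub]

omit [FiniteDimensional ℝ V] [MeasurableSpace V] [BorelSpace V] [FiniteDimensional ℝ P]
  [MeasurableSpace P] [BorelSpace P] in
/-- An almost-linear piece with `Kδ < 1` is mapped injectively. [cite: Federer1969, 3.2.3 (proof)] -/
theorem injOn_of_approximatesLinearOn (hA : AntilipschitzWith K A)
    (happ : ApproximatesLinearOn f A s δ) (hKδ : K * δ < 1) : InjOn f s := by
  intro x hx y hy hxy
  have hKδ' : ((K : ℝ) * δ) < 1 := by exact_mod_cast hKδ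
  have h := norm_sub_le_of_approximatesLinearOn hA happ hx hy
  rw [hxy, sub_self, norm_zero] at h
  have h0 : ‖A x - A y‖ ≤ 0 := by
    by_contra hne
    have : 0 < (1 - K * δ) * ‖A x - A y‖ := mul_pos (by linarith) (lt_of_not_ge hne)
    linarith
  exact hA.injective (sub_eq_zero.1 (norm_le_zero_iff.1 h0))

/-- **Mass of an almost-linear piece in a ball**: if `f` is `δ`-approximately the `K`-antilipschitz
linear map `A` on `s ⊆ P` (`dim P = k + 1`, `Kδ < 1`), then for `x₀ ∈ s` and `r ≥ 0`,
`𝓗^{k+1}(f(s) ∩ 𝐁(f x₀, r)) ≤ ((1+Kδ)/(1−Kδ))^{k+1} α(k+1) r^{k+1}`: the part of `s` mapped into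
the ball is mapped by `A` into the ball of radius `r/(1−Kδ)` of the plane `A(P)`, of
`𝓗^{k+1}`-measure `≤ α(k+1)(r/(1−Kδ))^{k+1}`, and `f(s)` is the image of `A(s)` under the
`(1+Kδ)`-Lipschitz map `f ∘ A⁻¹`. [cite: Federer1969, 3.2.3 (proof), 2.10.35] -/
theorem euclideanHausdorffMeasure_image_inter_closedBall_le (hP : Module.finrank ℝ P = k + 1)
    (hA : AntilipschitzWith K A) (happ : ApproximatesLinearOn f A s δ) (hKδ : K * δ < 1)
    {x₀ : P} (hx₀ : x₀ ∈ s) {r : ℝ} (hr : 0 ≤ r) :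
    (μHE[k + 1] : Measure V) (f '' s ∩ closedBall (f x₀) r) ≤
      ENNReal.ofReal (((1 + ((K * δ : ℝ≥0) : ℝ)) / (1 - ((K * δ : ℝ≥0) : ℝ))) ^ (k + 1)) *
        (unitBallVolume (k + 1) * ENNReal.ofReal (r ^ (k + 1))) := by
  classical
  have hKδ' : ((K * δ : ℝ≥0) : ℝ) < 1 := by exact_mod_cast hKδ
  have hKδc : ((K * δ : ℝ≥0) : ℝ) = (K : ℝ) * δ := NNReal.coe_mul K δ
  rw [hKδc] at hKδ' ⊢
  have hpos : (0 : ℝ) < 1 - K * δ := by linarith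
  set ρ : ℝ := r / (1 - K * δ) with hρ
  have hρ0 : 0 ≤ ρ := div_nonneg hr hpos.le
  -- the part of `s` mapped into the ball
  set E : Set P := s ∩ A ⁻¹' closedBall (A x₀) ρ with hE
  have hincl : f '' s ∩ closedBall (f x₀) r ⊆ f '' E := by
    rintro _ ⟨⟨x, hx, rfl⟩, hball⟩
    refine ⟨x, ⟨hx, ?_⟩, rfl⟩
    rw [mem_preimage, mem_closedBall, dist_eq_norm]
    rw [mem_closedBall, dist_eq_norm] at hball
    have key := norm_sub_le_of_approximatesLinearOn hA happ hx hx₀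
    rw [hρ, le_div_iff₀ hpos, mul_comm]
    exact key.trans hball
  -- the upper estimate on `E`
  have happE : ApproximatesLinearOn f A E δ := fun x hx y hy => happ x hx.1 y hy.1
  have h1 : (μHE[k + 1] : Measure V) (f '' E) ≤ ((1 + K * δ : ℝ≥0) : ℝ≥0∞) ^ (k + 1) *
      (ENNReal.ofReal (A : P →ₗ[ℝ] V).normDet * (μHE[k + 1] : Measure P) E) := by
    have := euclideanHausdorffMeasure_image_le_of_approximatesLinearOn hA happE
    rwa [hP] at this
  have h2 : ENNReal.ofReal (A : P →ₗ[ℝ] V).normDet * (μHE[k + 1] : Measure P) E =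
      (μHE[k + 1] : Measure V) (A '' E) := by
    have := (A : P →ₗ[ℝ] V).euclideanHausdorffMeasure_image E
    rw [hP] at this
    simpa only [ContinuousLinearMap.coe_coe] using this.symm
  -- `A(E)` lies in a ball of the plane `A(P)`
  set W : Submodule ℝ V := LinearMap.range (A : P →ₗ[ℝ] V) with hW
  have hAinj : Injective (A : P →ₗ[ℝ] V) := hA.injective
  have hWdim : Module.finrank ℝ W = k + 1 := by
    rw [hW, LinearMap.finrank_range_of_inj hAinj, hP]
  have h3 : (μHE[k + 1] : Measure V) (A '' E) ≤
      unitBallVolume (k + 1) * ENNReal.ofReal ρ ^ (k + 1) := by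
    have hsub : A '' E ⊆ closedBall (A x₀) ρ ∩ (W : Set V) := by
      rintro _ ⟨x, hx, rfl⟩
      exact ⟨hx.2, LinearMap.mem_range_self (A : P →ₗ[ℝ] V) x⟩
    calc (μHE[k + 1] : Measure V) (A '' E)
        ≤ (μHE[k + 1] : Measure V) (closedBall (A x₀) ρ ∩ (W : Set V)) := measure_mono hsub
      _ ≤ sphericalGauge (k + 1) (closedBall (A x₀) ρ) :=
          euclideanHausdorffMeasure_inter_le_sphericalGauge W hWdim _
      _ ≤ unitBallVolume (k + 1) * ENNReal.ofReal ρ ^ (k + 1) :=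
          sphericalGauge_le_of_subset_closedBall Subset.rfl
  -- arithmetic
  have hcoe : ((1 + K * δ : ℝ≥0) : ℝ≥0∞) ^ (k + 1) = ENNReal.ofReal ((1 + K * δ) ^ (k + 1)) := by
    rw [← ENNReal.ofReal_coe_nnreal, ← ENNReal.ofReal_pow (by positivity)]
    push_cast
    rfl
  calc (μHE[k + 1] : Measure V) (f '' s ∩ closedBall (f x₀) r)
      ≤ (μHE[k + 1] : Measure V) (f '' E) := measure_mono hincl
    _ ≤ ((1 + K * δ : ℝ≥0) : ℝ≥0∞) ^ (k + 1) * (μHE[k + 1] : Measure V) (A '' E) := by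
        rw [← h2]; exact h1
    _ ≤ ((1 + K * δ : ℝ≥0) : ℝ≥0∞) ^ (k + 1) *
          (unitBallVolume (k + 1) * ENNReal.ofReal ρ ^ (k + 1)) := by gcongr
    _ = ENNReal.ofReal (((1 + K * δ) / (1 - K * δ)) ^ (k + 1)) *
          (unitBallVolume (k + 1) * ENNReal.ofReal (r ^ (k + 1))) := by
        rw [hcoe, ← ENNReal.ofReal_pow hρ0, mul_left_comm, mul_left_comm (ENNReal.ofReal _),
          ← ENNReal.ofReal_mul (by positivity), ← ENNReal.ofReal_mul (by positivity)]
        congr 2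
        rw [hρ, div_pow, div_pow]
        field_simp

/-- **Upper density of an almost-linear piece**: in the situation of
`euclideanHausdorffMeasure_image_inter_closedBall_le`,
`Θ^{*(k+1)}(𝓗^{k+1} ⌞ f(s), y) ≤ ((1+Kδ)/(1−Kδ))^{k+1}` at every point `y ∈ f(s)`.
[cite: Federer1969, 3.2.3 (proof), 3.2.19] -/
theorem upperDensity_restrict_image_le (hP : Module.finrank ℝ P = k + 1)
    (hA : AntilipschitzWith K A) (happ : ApproximatesLinearOn f A s δ) (hKδ : K * δ < 1)
    {y : V} (hy : y ∈ f '' s) :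
    upperDensity (k + 1) ((μHE[k + 1] : Measure V).restrict (f '' s)) y ≤
      ENNReal.ofReal (((1 + ((K * δ : ℝ≥0) : ℝ)) / (1 - ((K * δ : ℝ≥0) : ℝ))) ^ (k + 1)) := by
  obtain ⟨x₀, hx₀, rfl⟩ := hy
  refine limsup_le_of_le (by isBoundedDefault) ?_
  refine eventually_nhdsWithin_of_forall fun r hr => ?_
  rw [Measure.restrict_apply measurableSet_closedBall, inter_comm]
  exact ENNReal.div_le_of_le_mul
    (euclideanHausdorffMeasure_image_inter_closedBall_le hP hA happ hKδ hx₀ (le_of_lt hr))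

end Piece

/-! ### Upper density at most one almost everywhere -/

section Density

/-- Step one of `ae_upperDensity_restrict_le_one_of_isCountablyRectifiable`: for every tolerance
`δ₀ ∈ (0, 1)`, `Θ^{*(k+1)}(𝓗^{k+1} ⌞ M, a) ≤ ((1+δ₀)/(1−δ₀))^{k+1}` for a.e. `a ∈ M`.
[cite: Federer1969, 3.2.19, 2.10.19 (4)] -/
theorem ae_upperDensity_restrict_le_of_isCountablyRectifiable {M : Set V}
    (hMm : MeasurableSet M) (hMr : IsCountablyRectifiable (k + 1) M)
    (hMf : (μHE[k + 1] : Measure V) M ≠ ⊤) {δ₀ : ℝ≥0} (hδ0 : 0 < δ₀) (hδ1 : δ₀ < 1) :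
    ∀ᵐ a ∂(μHE[k + 1] : Measure V).restrict M,
      upperDensity (k + 1) ((μHE[k + 1] : Measure V).restrict M) a ≤
        ENNReal.ofReal (((1 + (δ₀ : ℝ)) / (1 - δ₀)) ^ (k + 1)) := by
    classical
    set μ : Measure V := (μHE[k + 1] : Measure V).restrict M with hμ
    haveI hμfin : IsFiniteMeasure μ := isFiniteMeasure_restrict.2 hMf
    have hμle : μ ≤ (μHE[k + 1] : Measure V) := Measure.restrict_le_self
    set C : ℝ≥0∞ := ENNReal.ofReal (((1 + (δ₀ : ℝ)) / (1 - δ₀)) ^ (k + 1)) with hC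
    obtain ⟨f, hf, hcov⟩ := hMr
    choose L hL using hf
    have hP : Module.finrank ℝ (EuclideanSpace ℝ (Fin (k + 1))) = k + 1 := finrank_euclideanSpace_fin
    -- good sets of the parametrisations
    set S : ℕ → Set (EuclideanSpace ℝ (Fin (k + 1))) := fun i =>
      {u | DifferentiableAt ℝ (f i) u ∧ Injective (fderiv ℝ (f i) u)} with hS
    have hSm : ∀ i, MeasurableSet (S i) := fun i =>
      measurableSet_setOf_differentiableAt_injective (f i)
    have hSd : ∀ i, ∀ u ∈ S i, HasFDerivWithinAt (f i) (fderiv ℝ (f i) u) (S i) u :=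
      fun i u hu => hu.1.hasFDerivAt.hasFDerivWithinAt
    -- antilipschitz constants and the tolerance `δ₀ / K(A)`
    have hcA : ∀ A : EuclideanSpace ℝ (Fin (k + 1)) →L[ℝ] V, ∃ K : ℝ≥0, 0 < K ∧
        (Injective A → AntilipschitzWith K A) := by
      intro A
      by_cases hA : Injective A
      · obtain ⟨K, hK0, hK⟩ := (A : EuclideanSpace ℝ (Fin (k + 1)) →ₗ[ℝ] V).exists_antilipschitzWith
          (LinearMap.ker_eq_bot.2 hA)
        exact ⟨K, hK0, fun _ => hK⟩
      · exact ⟨1, one_pos, fun h => absurd h hA⟩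
    choose K hK0 hKanti using hcA
    have hpart := fun i => exists_partition_approximatesLinearOn_of_hasFDerivWithinAt (f i) (S i)
      (fun u => fderiv ℝ (f i) u) (hSd i) (fun A => δ₀ * (K A)⁻¹)
      (fun A => mul_ne_zero hδ0.ne' (inv_ne_zero (hK0 A).ne'))
    choose t A _ htm htcov happ hAeq using hpart
    have hKr : ∀ B : EuclideanSpace ℝ (Fin (k + 1)) →L[ℝ] V, K B * (δ₀ * (K B)⁻¹) = δ₀ := fun B => by
      rw [mul_comm, inv_mul_cancel_right₀ (hK0 B).ne']
    -- per piece
    have hpiece : ∀ i q, ∀ᵐ a ∂μ, a ∈ f i '' (S i ∩ t i q) → upperDensity (k + 1) μ a ≤ C := by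
      intro i q
      rcases (S i ∩ t i q).eq_empty_or_nonempty with hempty | hne
      · refine Eventually.of_forall fun a ha => ?_
        rw [hempty, image_empty] at ha
        exact absurd ha (notMem_empty a)
      set G : Set V := f i '' (S i ∩ t i q) with hG
      have hAinj : Injective (A i q) := by
        obtain ⟨y, hy, hAy⟩ := hAeq i ⟨_, hne.some_mem.1⟩ q
        rw [hAy]
        exact hy.2
      have hanti : AntilipschitzWith (K (A i q)) (A i q) := hKanti _ hAinj
      have happ' : ApproximatesLinearOn (f i) (A i q) (S i ∩ t i q) (δ₀ * (K (A i q))⁻¹) :=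
        happ i q
      have hKδ : K (A i q) * (δ₀ * (K (A i q))⁻¹) < 1 := by rw [hKr]; exact hδ1
      have hGm : MeasurableSet G :=
        ((hSm i).inter (htm i q)).image_of_continuousOn_injOn (hL i).continuous.continuousOn
          (injOn_of_approximatesLinearOn hanti happ' hKδ)
      -- the rest of `M` has density zero a.e. on `G`
      have hrest : ∀ᵐ x ∂(μHE[k + 1] : Measure V).restrict G,
          upperDensity (k + 1) (μ.restrict Gᶜ) x = 0 :=
        ae_restrict_upperDensity_eq_zero (μ.restrict Gᶜ) (k + 1) hGm
          (by rw [Measure.restrict_apply hGm, inter_compl_self, measure_empty])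
      have hrest' : ∀ᵐ x ∂μ, x ∈ G → upperDensity (k + 1) (μ.restrict Gᶜ) x = 0 := by
        rw [← ae_restrict_iff' hGm]
        exact ae_mono (Measure.restrict_mono subset_rfl hμle) hrest
      filter_upwards [hrest'] with x hx hxG
      have hsplit : μ.restrict G + μ.restrict Gᶜ = μ := Measure.restrict_add_restrict_compl hGm
      calc upperDensity (k + 1) μ x
          = upperDensity (k + 1) (μ.restrict G + μ.restrict Gᶜ) x := by rw [hsplit]
        _ = upperDensity (k + 1) (μ.restrict G) x :=
            upperDensity_add_eq_left_of_eq_zero _ _ (hx hxG)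
        _ ≤ upperDensity (k + 1) ((μHE[k + 1] : Measure V).restrict G) x :=
            upperDensity_mono (Measure.restrict_mono subset_rfl hμle) x
        _ ≤ ENNReal.ofReal (((1 + ((K (A i q) * (δ₀ * (K (A i q))⁻¹) : ℝ≥0) : ℝ)) /
              (1 - ((K (A i q) * (δ₀ * (K (A i q))⁻¹) : ℝ≥0) : ℝ))) ^ (k + 1)) :=
            upperDensity_restrict_image_le hP hanti happ' hKδ hxG
        _ = C := by rw [hKr]
    -- the null sets: uncovered part of `M`, and images of the bad sets
    have hnull1 : μ (M \ ⋃ i, range (f i)) = 0 := nonpos_iff_eq_zero.1 ((hμle _).trans hcov.le)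
    have hnull2 : ∀ i, μ (f i '' (S i)ᶜ) = 0 := by
      intro i
      have h0 := hausdorffMeasure_image_compl_good_eq_zero (m := k + 1) (hL i)
      have h1 : (μHE[k + 1] : Measure V) (f i '' (S i)ᶜ) = 0 := by
        rw [Measure.euclideanHausdorffMeasure_def, Measure.smul_apply]
        exact smul_eq_zero_of_right _ h0
      exact nonpos_iff_eq_zero.1 ((hμle _).trans h1.le)
    have hall : ∀ᵐ a ∂μ, ∀ i q, a ∈ f i '' (S i ∩ t i q) → upperDensity (k + 1) μ a ≤ C :=
      ae_all_iff.2 fun i => ae_all_iff.2 fun q => hpiece i q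
    have haeM : ∀ᵐ a ∂μ, a ∈ M := ae_restrict_mem hMm
    have hae1 : ∀ᵐ a ∂μ, a ∉ M \ ⋃ i, range (f i) := (measure_eq_zero_iff_ae_notMem.1 hnull1 :)
    have hae2 : ∀ᵐ a ∂μ, ∀ i, a ∉ f i '' (S i)ᶜ :=
      ae_all_iff.2 fun i => (measure_eq_zero_iff_ae_notMem.1 (hnull2 i) :)
    filter_upwards [hall, haeM, hae1, hae2] with a hall haM ha1 ha2
    have hau : a ∈ ⋃ i, range (f i) := by
      by_contra h
      exact ha1 ⟨haM, h⟩
    obtain ⟨i, hi⟩ := mem_iUnion.1 hau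
    obtain ⟨u, hua⟩ := hi
    have hu : u ∈ S i := by
      by_contra h
      exact ha2 i ⟨u, h, hua⟩
    obtain ⟨q, hq⟩ := mem_iUnion.1 (htcov i hu)
    exact hall i q ⟨u, ⟨hu, hq⟩, hua⟩

/-- **`Θ^{*(k+1)}(𝓗^{k+1} ⌞ M, a) ≤ 1` for `𝓗^{k+1}`-almost every `a ∈ M`**, for a Borel countably
`(k+1)`-rectifiable set `M` with `𝓗^{k+1}(M) < ∞` (normalised Hausdorff measure `μHE[k+1]`; the
upper half of the density theorem for rectifiable sets, proved through almost-linear pieces of the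
Lipschitz parametrisations and [Federer1969, 2.10.19 (4)] for the complementary pieces).
[cite: Federer1969, 3.2.19; Mattila1995, 16.2] -/
theorem ae_upperDensity_restrict_le_one_of_isCountablyRectifiable {M : Set V}
    (hMm : MeasurableSet M) (hMr : IsCountablyRectifiable (k + 1) M)
    (hMf : (μHE[k + 1] : Measure V) M ≠ ⊤) :
    ∀ᵐ a ∂(μHE[k + 1] : Measure V).restrict M,
      upperDensity (k + 1) ((μHE[k + 1] : Measure V).restrict M) a ≤ 1 := by
  -- `δ₀ = 1/(2(j+1)) → 0`
  set δJ : ℕ → ℝ≥0 := fun j => (2 * ((j : ℝ≥0) + 1))⁻¹ with hδJ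
  have hδJ0 : ∀ j, 0 < δJ j := fun j => by simp only [hδJ]; positivity
  have hδJ1 : ∀ j, δJ j < 1 := fun j => by
    simp only [hδJ]
    rw [inv_lt_one_iff₀]
    right
    have : (1 : ℝ≥0) ≤ (j : ℝ≥0) + 1 := le_add_self
    calc (1 : ℝ≥0) < 2 * 1 := by norm_num
      _ ≤ 2 * ((j : ℝ≥0) + 1) := by gcongr
  have hae : ∀ᵐ a ∂(μHE[k + 1] : Measure V).restrict M, ∀ j : ℕ,
      upperDensity (k + 1) ((μHE[k + 1] : Measure V).restrict M) a ≤
        ENNReal.ofReal (((1 + (δJ j : ℝ)) / (1 - δJ j)) ^ (k + 1)) :=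
    ae_all_iff.2 fun j =>
      ae_upperDensity_restrict_le_of_isCountablyRectifiable hMm hMr hMf (hδJ0 j) (hδJ1 j)
  have hlim : Tendsto (fun j : ℕ => ENNReal.ofReal (((1 + (δJ j : ℝ)) / (1 - δJ j)) ^ (k + 1)))
      atTop (𝓝 1) := by
    have hδ : Tendsto (fun j : ℕ => ((δJ j : ℝ≥0) : ℝ)) atTop (𝓝 0) := by
      have h1 : Tendsto (fun j : ℕ => (1 : ℝ) / 2 * (1 / ((j : ℝ) + 1))) atTop (𝓝 ((1 : ℝ) / 2 * 0)) :=
        tendsto_one_div_add_atTop_nhds_zero_nat.const_mul _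
      rw [mul_zero] at h1
      refine h1.congr fun j => ?_
      simp only [hδJ, NNReal.coe_inv, NNReal.coe_mul, NNReal.coe_ofNat, NNReal.coe_add,
        NNReal.coe_natCast, NNReal.coe_one]
      field_simp
    have h2 : Tendsto (fun j : ℕ => ((1 + (δJ j : ℝ)) / (1 - δJ j)) ^ (k + 1)) atTop
        (𝓝 (((1 + 0) / (1 - 0)) ^ (k + 1))) :=
      ((tendsto_const_nhds.add hδ).div (tendsto_const_nhds.sub hδ) (by norm_num)).pow (k + 1)
    rw [add_zero, sub_zero, div_one, one_pow] at h2
    have h3 := (ENNReal.continuous_ofReal.tendsto 1).comp h2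
    rwa [ENNReal.ofReal_one] at h3
  filter_upwards [hae] with a ha
  exact ge_of_tendsto' hlim fun j => ha j

/-- **Sharp growth of `𝓗^{k+1} ⌞ M` at almost every point of a rectifiable set**, `hup` form:
for a Borel countably `(k+1)`-rectifiable `M` with `𝓗^{k+1}(M) < ∞`, for `𝓗^{k+1}`-a.e. `a ∈ M`
and every `t > 1`, eventually as `r → 0+`: `(𝓗^{k+1} ⌞ M)(𝐁(a, r)) ≤ t · α(k+1) r^{k+1}`.
[cite: Federer1969, 3.2.19; Mattila1995, 16.2] -/
theorem ae_eventually_closedBall_le_of_isCountablyRectifiable {M : Set V}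
    (hMm : MeasurableSet M) (hMr : IsCountablyRectifiable (k + 1) M)
    (hMf : (μHE[k + 1] : Measure V) M ≠ ⊤) :
    ∀ᵐ a ∂(μHE[k + 1] : Measure V).restrict M, ∀ t : ℝ≥0∞, 1 < t →
      ∀ᶠ r in 𝓝[>] (0 : ℝ), (μHE[k + 1] : Measure V).restrict M (closedBall a r) ≤
        t * (unitBallVolume (k + 1) * ENNReal.ofReal (r ^ (k + 1))) := by
  filter_upwards [ae_upperDensity_restrict_le_one_of_isCountablyRectifiable hMm hMr hMf]
    with a ha t ht
  have hlt : limsup (fun r : ℝ => (μHE[k + 1] : Measure V).restrict M (closedBall a r) /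
      (unitBallVolume (k + 1) * ENNReal.ofReal (r ^ (k + 1)))) (𝓝[>] (0 : ℝ)) < t :=
    lt_of_le_of_lt ha ht
  filter_upwards [eventually_lt_of_limsup_lt hlt, self_mem_nhdsWithin] with r hr hr0
  rw [mem_Ioi] at hr0
  have h0 : unitBallVolume (k + 1) * ENNReal.ofReal (r ^ (k + 1)) ≠ 0 :=
    mul_ne_zero (unitBallVolume_ne_zero _) (ENNReal.ofReal_pos.2 (by positivity)).ne'
  have hT : unitBallVolume (k + 1) * ENNReal.ofReal (r ^ (k + 1)) ≠ ⊤ :=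
    ENNReal.mul_ne_top (unitBallVolume_ne_top _) ENNReal.ofReal_ne_top
  exact ((ENNReal.div_lt_iff (Or.inl h0) (Or.inl hT)).1 hr).le

end Density

end Literature.Geometry.GeometricMeasureTheory
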